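import Summits.QuantumFields.QCD.Theorems.HeatSlicedQuarksSmallFieldUltracontractivityStubRowDuhamel
import Summits.QuantumFields.QCD.Theorems.HeatSlicedQuarksDaviesGaffneyWilsonRange
import Literature.MathematicalPhysics.QuantumLattice.GrassmannIntegralWilsonProofs
import Literature.MathematicalPhysics.QuantumLattice.LatticeToriProofs
import Mathlib.Analysis.SpecialFunctions.Integrals.Basic

/-!
# Caloric fixed point — part D3a: scales, supports and the integral of the bounding function
(helpers of the line lead for `stub_caloricFixedPoint`, crux `SmallFieldUltracontractivity`,
item stmt-QuantumFields-8871, line `point-centred-axial-parabolic`)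

**The main step.**  For an `SU(3)` field `U`, mass `m ∈ [-1/2, 1]`, centre `x`, time `s ≥ 4096` with
`rs = √s`, `n = ⌈rs⌉`, `N = ⌊rs/4⌋`, on a torus of side `L ≥ 1024 n`, assume the links within `torusDist ≤ 128 n`
of `x` have deficit `≤ 8κ²/s` and the HEREDITARY hypothesis: every row of `e^{-(s/8)H_U}` based within
`torusDist ≤ 64 n` of `x` has `ℓ²` norm `≤ 8B/s`.  Then
`s · ‖row_{(x,a,α)}(e^{-sH_U})‖₂ ≤ 3 C_r + 3072 C_c + 3072 C_r (1/√c_r + 3138) · κB`,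
where `C_r, c_r` are the constants of the free row bounds and `C_c` the constant of the commutator bound.
PROOF = the cut-off Duhamel parametrix of the line: `stub_rowDuhamel` with the polynomial weight
`θ(τ) = 1 − (4(s−τ)/(3s))²` on `[s/4, s]` and the product cutoff of scale `N` represents the row as
`∫_{s/4}^{s} row(F(τ)) dτ`; the row of `F(τ)` is bounded pointwise (registered form of `stub_integrandRow`)
using the free row bounds, the commutator bound, the smoothing row (`stub_smoothingRow`), the hopping
row/column sums (`stub_hoppingRowSums`, `λ = 4κ/√s`), the monotonicity of heat rows and the `Q`-trick
(`stub_heatRowCalculus` (2),(3), hereditary hypothesis at the single time `s/8`); Minkowski by duality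
(`stub_rowIntegralDuality`), the two elementary integrals (`stub_timeIntegrals`) and bookkeeping of the
constants close the estimate.  All general facts enter as hypotheses in their registered forms, so this
file depends only on `StubRowDuhamel` (continuity of the integrand entries) and tree lemmas.
-/

noncomputable section

namespace Summit.QuantumFields.QCD.Cruxes.SmallFieldUltracontractivity.PointCentredAxialParabolic

open Literature.MathematicalPhysics.QuantumLattice Literature.MathematicalPhysics.QuantumFieldTheory
open Literature.Probability.LatticeModels (TorusSite)
open Summit.QuantumFields.QCD.Theorems.SmallFieldUltracontractivity.Negative
open Summit.QuantumFields.QCD.Theorems.HeatSlicedQuarksDaviesGaffney (wilsonDirac_apply_eq_zero)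
open scoped Matrix ComplexConjugate
open MeasureTheory intervalIntegral

/-! ### Scales -/

/-- The scale bookkeeping of the main step: with `rs = √s ≥ 64`, `n = ⌈rs⌉`, `N = ⌊rs/4⌋`. -/
theorem scale_facts {s : ℝ} (hs : (4096 : ℝ) ≤ s) :
    0 < s ∧ 64 ≤ Real.sqrt s ∧ Real.sqrt s ^ 2 = s ∧
      Real.sqrt s ≤ (⌈Real.sqrt s⌉₊ : ℝ) ∧ ((⌈Real.sqrt s⌉₊ : ℕ) : ℝ) ≤ Real.sqrt s + 1 ∧
      ((⌊Real.sqrt s / 4⌋₊ : ℕ) : ℝ) ≤ Real.sqrt s / 4 ∧ Real.sqrt s / 8 ≤ ((⌊Real.sqrt s / 4⌋₊ : ℕ) : ℝ) ∧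
      16 ≤ ⌊Real.sqrt s / 4⌋₊ ∧ 4 * ⌊Real.sqrt s / 4⌋₊ ≤ ⌈Real.sqrt s⌉₊ ∧ 64 ≤ ⌈Real.sqrt s⌉₊ := by
  have hs0 : 0 < s := by linarith
  have hrs : 64 ≤ Real.sqrt s := by
    rw [show (64 : ℝ) = Real.sqrt (64 ^ 2) by rw [Real.sqrt_sq (by norm_num)]]
    exact Real.sqrt_le_sqrt (by norm_num; linarith)
  have hrs0 : 0 ≤ Real.sqrt s := Real.sqrt_nonneg s
  have hsq : Real.sqrt s ^ 2 = s := Real.sq_sqrt hs0.le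
  have hceil : Real.sqrt s ≤ (⌈Real.sqrt s⌉₊ : ℝ) := Nat.le_ceil _
  have hceil' : ((⌈Real.sqrt s⌉₊ : ℕ) : ℝ) ≤ Real.sqrt s + 1 := (Nat.ceil_lt_add_one hrs0).le
  have hfloor : ((⌊Real.sqrt s / 4⌋₊ : ℕ) : ℝ) ≤ Real.sqrt s / 4 := Nat.floor_le (by positivity)
  have hfloor' : Real.sqrt s / 4 < ((⌊Real.sqrt s / 4⌋₊ : ℕ) : ℝ) + 1 := Nat.lt_floor_add_one _
  have hN8 : Real.sqrt s / 8 ≤ ((⌊Real.sqrt s / 4⌋₊ : ℕ) : ℝ) := by linarith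
  have h16 : 16 ≤ ⌊Real.sqrt s / 4⌋₊ := by
    have : (15 : ℝ) < ((⌊Real.sqrt s / 4⌋₊ : ℕ) : ℝ) := by linarith
    have : (15 : ℕ) < ⌊Real.sqrt s / 4⌋₊ := by exact_mod_cast this
    omega
  have h4N : 4 * ⌊Real.sqrt s / 4⌋₊ ≤ ⌈Real.sqrt s⌉₊ := by
    have : ((4 * ⌊Real.sqrt s / 4⌋₊ : ℕ) : ℝ) ≤ (⌈Real.sqrt s⌉₊ : ℝ) := by
      push_cast; linarith
    exact_mod_cast this
  have h64 : 64 ≤ ⌈Real.sqrt s⌉₊ := by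
    have : ((64 : ℕ) : ℝ) ≤ (⌈Real.sqrt s⌉₊ : ℝ) := by push_cast; linarith
    exact_mod_cast this
  exact ⟨hs0, hrs, hsq, hceil, hceil', hfloor, hN8, h16, h4N, h64⟩

/-! ### The time weight (copies of the facts landed in part C) -/

/-- `θ_s` is differentiable with derivative `(32/(9s²))(s − τ)` (`s ≠ 0`). -/
theorem hasDerivAt_timeWeight' {s : ℝ} (hs : s ≠ 0) (τ : ℝ) :
    HasDerivAt (fun τ : ℝ => 1 - (4 * (s - τ) / (3 * s)) ^ 2) (32 / (9 * s ^ 2) * (s - τ)) τ := by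
  have h1 : HasDerivAt (fun τ : ℝ => 4 * (s - τ) / (3 * s)) (4 * -1 / (3 * s)) τ :=
    (((hasDerivAt_id' τ).const_sub s).const_mul 4).div_const (3 * s)
  have h2 := (h1.fun_pow 2).const_sub 1
  refine h2.congr_deriv ?_
  norm_num
  field_simp
  ring

/-! ### Supports -/

/-- If `(K · diagonal d · Dᴴ)_{ik} ≠ 0` then some `q` has `d q ≠ 0` and `D_{kq} ≠ 0`. -/
theorem exists_of_mul_diagonal_mul_conjTranspose_ne_zero {κ : Type*} [Fintype κ] [DecidableEq κ]
    (K D : Matrix κ κ ℂ) (d : κ → ℂ) {i k : κ} (h : (K * Matrix.diagonal d * Dᴴ) i k ≠ 0) :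
    ∃ q, d q ≠ 0 ∧ D k q ≠ 0 := by
  rw [Matrix.mul_apply] at h
  obtain ⟨q, -, hq⟩ := Finset.exists_ne_zero_of_sum_ne_zero h
  rw [Matrix.mul_diagonal, Matrix.conjTranspose_apply] at hq
  refine ⟨q, fun h0 => hq (by simp [h0]), fun h0 => hq (by simp [h0])⟩

/-- If `(K · diagonal d)_{ik} ≠ 0` then `d k ≠ 0`. -/
theorem ne_zero_of_mul_diagonal_ne_zero {κ : Type*} [Fintype κ] [DecidableEq κ]
    (K : Matrix κ κ ℂ) (d : κ → ℂ) {i k : κ} (h : (K * Matrix.diagonal d) i k ≠ 0) : d k ≠ 0 := by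
  rw [Matrix.mul_diagonal] at h
  exact fun h0 => h (by simp [h0])

/-! ### The integral of the bounding function -/

/-- The bounding function `G` of the main step is continuous on `[s/4, s]`. -/
theorem continuousOn_boundFn (A₀ B₁ B₂ Cr cr m Nr s : ℝ) :
    ContinuousOn (fun τ : ℝ => A₀ + B₁ * (Cr * Real.exp (-(cr * (s - τ) * m ^ 2)) *
        (|m| + 32 / Real.sqrt (1 + (s - τ)) + 512 / Nr)) + B₂ * (Cr * Real.exp (-(cr * (s - τ) * m ^ 2))))
      (Set.Icc (s / 4) s) := by
  refine ContinuousOn.add (ContinuousOn.add continuousOn_const ?_) ?_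
  · refine ContinuousOn.mul continuousOn_const (ContinuousOn.mul (by fun_prop) ?_)
    refine ContinuousOn.add (ContinuousOn.add continuousOn_const ?_) continuousOn_const
    refine ContinuousOn.div continuousOn_const (by fun_prop) fun τ hτ => ?_
    exact (Real.sqrt_pos.mpr (by linarith [hτ.2])).ne'
  · fun_prop

/-- **The integral of the bounding function.**  For `s ≥ 1`, `cr > 0`, `Cr, B₁, B₂ ≥ 0`, `Nr > 0`
(the two elementary integrals being supplied in the registered form of `stub_timeIntegrals`; `s ≥ 4`):
`∫_{s/4}^{s} G ≤ (3s/4) A₀ + B₁ Cr (√s/√cr + 64 √s + 384 s/Nr) + B₂ Cr (3s/4)`. -/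
theorem integral_boundFn_le
    (hInt : ∀ (c T m : ℝ), 0 < c → 0 ≤ T →
      (∫ σ in (0:ℝ)..T, |m| * Real.exp (-(c * σ * m ^ 2)) ≤ Real.sqrt (T / c)) ∧
      (∫ σ in (0:ℝ)..T, 1 / Real.sqrt (1 + σ) ≤ 2 * Real.sqrt (1 + T)))
    {A₀ B₁ B₂ Cr cr m Nr s : ℝ} (hs : 4 ≤ s) (hcr : 0 < cr) (hCr : 0 ≤ Cr)
    (hB₁ : 0 ≤ B₁) (hB₂ : 0 ≤ B₂) (hNr : 0 < Nr) :
    ∫ τ in (s / 4)..s, (A₀ + B₁ * (Cr * Real.exp (-(cr * (s - τ) * m ^ 2)) *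
        (|m| + 32 / Real.sqrt (1 + (s - τ)) + 512 / Nr)) + B₂ * (Cr * Real.exp (-(cr * (s - τ) * m ^ 2)))) ≤
      3 * s / 4 * A₀ + B₁ * (Cr * (Real.sqrt s / Real.sqrt cr + 64 * Real.sqrt s + 384 * s / Nr)) +
        B₂ * (Cr * (3 * s / 4)) := by
  have hs0 : 0 < s := by linarith
  have h14 : s / 4 ≤ s := by linarith
  -- the three elementary pieces, as functions of `τ`
  set f₁ : ℝ → ℝ := fun τ => |m| * Real.exp (-(cr * (s - τ) * m ^ 2)) with hf₁
  set f₂ : ℝ → ℝ := fun τ => 1 / Real.sqrt (1 + (s - τ)) with hf₂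
  have hc₁ : ContinuousOn f₁ (Set.Icc (s / 4) s) := by rw [hf₁]; fun_prop
  have hc₂ : ContinuousOn f₂ (Set.Icc (s / 4) s) := by
    rw [hf₂]
    refine ContinuousOn.div continuousOn_const (by fun_prop) fun τ hτ => ?_
    exact (Real.sqrt_pos.mpr (by linarith [hτ.2])).ne'
  have hi₁ : IntervalIntegrable f₁ volume (s / 4) s := hc₁.intervalIntegrable_of_Icc h14
  have hi₂ : IntervalIntegrable f₂ volume (s / 4) s := hc₂.intervalIntegrable_of_Icc h14
  -- pointwise bound of the integrand by `g = A₀ + B₁ Cr (f₁ + 32 f₂ + 512/Nr) + B₂ Cr`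
  have hpt : ∀ τ ∈ Set.Icc (s / 4) s,
      A₀ + B₁ * (Cr * Real.exp (-(cr * (s - τ) * m ^ 2)) * (|m| + 32 / Real.sqrt (1 + (s - τ)) + 512 / Nr)) +
        B₂ * (Cr * Real.exp (-(cr * (s - τ) * m ^ 2))) ≤
      (A₀ + B₂ * Cr) + B₁ * Cr * (f₁ τ + 32 * f₂ τ + 512 / Nr) := by
    intro τ hτ
    have he1 : Real.exp (-(cr * (s - τ) * m ^ 2)) ≤ 1 := by
      rw [Real.exp_le_one_iff, neg_nonpos]
      have : 0 ≤ s - τ := by linarith [hτ.2]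
      positivity
    have he0 : 0 ≤ Real.exp (-(cr * (s - τ) * m ^ 2)) := (Real.exp_pos _).le
    have hsq0 : 0 < Real.sqrt (1 + (s - τ)) := Real.sqrt_pos.mpr (by linarith [hτ.2])
    have hin0 : 0 ≤ 32 / Real.sqrt (1 + (s - τ)) + 512 / Nr := by positivity
    have hA : Real.exp (-(cr * (s - τ) * m ^ 2)) * (|m| + 32 / Real.sqrt (1 + (s - τ)) + 512 / Nr) ≤
        f₁ τ + 32 * f₂ τ + 512 / Nr := by
      rw [hf₁, hf₂]
      have : Real.exp (-(cr * (s - τ) * m ^ 2)) * (|m| + 32 / Real.sqrt (1 + (s - τ)) + 512 / Nr) =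
          |m| * Real.exp (-(cr * (s - τ) * m ^ 2)) +
            Real.exp (-(cr * (s - τ) * m ^ 2)) * (32 / Real.sqrt (1 + (s - τ)) + 512 / Nr) := by ring
      rw [this, add_assoc]
      refine add_le_add le_rfl ?_
      calc Real.exp (-(cr * (s - τ) * m ^ 2)) * (32 / Real.sqrt (1 + (s - τ)) + 512 / Nr)
          ≤ 1 * (32 / Real.sqrt (1 + (s - τ)) + 512 / Nr) := mul_le_mul_of_nonneg_right he1 hin0
        _ = 32 * (1 / Real.sqrt (1 + (s - τ))) + 512 / Nr := by ring
    have hB : Cr * Real.exp (-(cr * (s - τ) * m ^ 2)) ≤ Cr := by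
      calc Cr * Real.exp (-(cr * (s - τ) * m ^ 2)) ≤ Cr * 1 := mul_le_mul_of_nonneg_left he1 hCr
        _ = Cr := mul_one Cr
    have hA' : B₁ * (Cr * Real.exp (-(cr * (s - τ) * m ^ 2)) * (|m| + 32 / Real.sqrt (1 + (s - τ)) + 512 / Nr))
        ≤ B₁ * Cr * (f₁ τ + 32 * f₂ τ + 512 / Nr) := by
      rw [mul_assoc Cr, mul_assoc B₁]
      exact mul_le_mul_of_nonneg_left (mul_le_mul_of_nonneg_left hA hCr) hB₁
    have hB' : B₂ * (Cr * Real.exp (-(cr * (s - τ) * m ^ 2))) ≤ B₂ * Cr := mul_le_mul_of_nonneg_left hB hB₂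
    linarith
  have hcontL := continuousOn_boundFn A₀ B₁ B₂ Cr cr m Nr s
  have hcontR : ContinuousOn (fun τ => (A₀ + B₂ * Cr) + B₁ * Cr * (f₁ τ + 32 * f₂ τ + 512 / Nr))
      (Set.Icc (s / 4) s) := by
    refine ContinuousOn.add continuousOn_const (ContinuousOn.mul continuousOn_const ?_)
    exact (hc₁.add (hc₂.const_smul (32:ℝ) |>.congr fun τ _ => by simp [smul_eq_mul])).add continuousOn_const
  have hmono : (∫ τ in (s / 4)..s, (A₀ + B₁ * (Cr * Real.exp (-(cr * (s - τ) * m ^ 2)) *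
        (|m| + 32 / Real.sqrt (1 + (s - τ)) + 512 / Nr)) + B₂ * (Cr * Real.exp (-(cr * (s - τ) * m ^ 2))))) ≤
      ∫ τ in (s / 4)..s, ((A₀ + B₂ * Cr) + B₁ * Cr * (f₁ τ + 32 * f₂ τ + 512 / Nr)) :=
    intervalIntegral.integral_mono_on h14 (hcontL.intervalIntegrable_of_Icc (μ := volume) h14)
      (hcontR.intervalIntegrable_of_Icc (μ := volume) h14) hpt
  refine hmono.trans ?_
  -- compute `∫ g`
  have hi₃ : IntervalIntegrable (fun τ => f₁ τ + 32 * f₂ τ) volume (s / 4) s := hi₁.add (hi₂.const_mul 32)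
  have hi₄ : IntervalIntegrable (fun τ => f₁ τ + 32 * f₂ τ + 512 / Nr) volume (s / 4) s :=
    hi₃.add intervalIntegrable_const
  -- the two elementary integrals
  have hI1 : ∫ τ in (s / 4)..s, f₁ τ ≤ Real.sqrt s / Real.sqrt cr := by
    have hsub := intervalIntegral.integral_comp_sub_left (fun σ => |m| * Real.exp (-(cr * σ * m ^ 2))) s
      (a := s / 4) (b := s)
    simp only [sub_self] at hsub
    rw [hf₁, hsub, show s - s / 4 = 3 * s / 4 by ring]
    refine ((hInt cr (3 * s / 4) m hcr (by positivity)).1).trans ?_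
    rw [Real.sqrt_div' _ hcr.le]
    exact div_le_div_of_nonneg_right (Real.sqrt_le_sqrt (by linarith)) (Real.sqrt_nonneg _)
  have hI2 : ∫ τ in (s / 4)..s, f₂ τ ≤ 2 * Real.sqrt s := by
    have hsub := intervalIntegral.integral_comp_sub_left (fun σ => 1 / Real.sqrt (1 + σ)) s (a := s / 4) (b := s)
    simp only [sub_self] at hsub
    rw [hf₂, hsub, show s - s / 4 = 3 * s / 4 by ring]
    refine ((hInt cr (3 * s / 4) m hcr (by positivity)).2).trans ?_
    exact mul_le_mul_of_nonneg_left (Real.sqrt_le_sqrt (by linarith)) (by norm_num)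
  have e1 : ∫ τ in (s / 4)..s, ((A₀ + B₂ * Cr) + B₁ * Cr * (f₁ τ + 32 * f₂ τ + 512 / Nr)) =
      (s - s / 4) * (A₀ + B₂ * Cr) + B₁ * Cr * ((∫ τ in (s / 4)..s, f₁ τ) + 32 * (∫ τ in (s / 4)..s, f₂ τ) +
        (s - s / 4) * (512 / Nr)) := by
    rw [intervalIntegral.integral_add intervalIntegrable_const (hi₄.const_mul _), intervalIntegral.integral_const,
      intervalIntegral.integral_const_mul, intervalIntegral.integral_add hi₃ intervalIntegrable_const,
      intervalIntegral.integral_const, intervalIntegral.integral_add hi₁ (hi₂.const_mul 32),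
      show (∫ τ in (s / 4)..s, 32 * f₂ τ) = 32 * ∫ τ in (s / 4)..s, f₂ τ from
        intervalIntegral.integral_const_mul 32 f₂]
    simp only [smul_eq_mul]
  rw [e1]
  have hBC : 0 ≤ B₁ * Cr := mul_nonneg hB₁ hCr
  have hin : (∫ τ in (s / 4)..s, f₁ τ) + 32 * (∫ τ in (s / 4)..s, f₂ τ) + (s - s / 4) * (512 / Nr) ≤
      Real.sqrt s / Real.sqrt cr + 64 * Real.sqrt s + 384 * s / Nr := by
    have : (s - s / 4) * (512 / Nr) = 384 * s / Nr := by ring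
    rw [this]
    linarith
  have hmul := mul_le_mul_of_nonneg_left hin hBC
  have hrhs : 3 * s / 4 * A₀ + B₁ * (Cr * (Real.sqrt s / Real.sqrt cr + 64 * Real.sqrt s + 384 * s / Nr)) +
      B₂ * (Cr * (3 * s / 4)) = (s - s / 4) * (A₀ + B₂ * Cr) +
        B₁ * Cr * (Real.sqrt s / Real.sqrt cr + 64 * Real.sqrt s + 384 * s / Nr) := by ring
  rw [hrhs]
  linarith

/-! ### The main step -/

/-- Abbreviation-free product cutoff used below (kept as a separate definition-free lemma: its value at
the centre is `1`). -/
theorem diagonal_cutoff_mul_apply_self {L : ℕ} [NeZero L] (x : TorusSite 4 L) (N : ℕ)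
    (hcut1 : (∏ ν : Fin 4, (max 0 (1 - (max 0 ((min ((x - x) ν).val (L - ((x - x) ν).val) : ℝ) / (N : ℝ) - 1)) ^ 2)) ^ 2) = 1)
    (X : Matrix (TorusSite 4 L × Fin 3 × Fin 4) (TorusSite 4 L × Fin 3 × Fin 4) ℂ) (a : Fin 3) (α : Fin 4)
    (j : TorusSite 4 L × Fin 3 × Fin 4) :
    (Matrix.diagonal (fun j : TorusSite 4 L × Fin 3 × Fin 4 =>
        (((∏ ν : Fin 4, (max 0 (1 - (max 0 ((min ((j.1 - x) ν).val (L - ((j.1 - x) ν).val) : ℝ) / (N : ℝ) - 1)) ^ 2)) ^ 2) : ℝ) : ℂ))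
      * X) (x, a, α) j = X (x, a, α) j := by
  rw [Matrix.diagonal_mul]
  simp only [hcut1, Complex.ofReal_one, one_mul]

/-- The closing arithmetic of the main step: with `rs² = s`, `rs/8 ≤ N`, the four integrated terms are
bounded by `3 Cr + 3072 Cc + 3072 Cr (1/√cr + 3138) κB`. -/
theorem final_arith {s rs Cr Cc cr κ B : ℝ} {N : ℕ} (hs0 : 0 < s) (hrs0 : 0 < rs) (hsq : rs ^ 2 = s)
    (hN8 : rs / 8 ≤ ((N : ℕ) : ℝ)) (hNpos : (0 : ℝ) < N) (hCr : 0 ≤ Cr) (hCc : 0 ≤ Cc)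
    (hκ : 0 ≤ κ) (hB : 0 ≤ B) :
    s * (3 * s / 4 * (Cc / (N : ℝ) ^ 4 + 32 / (9 * s ^ 2) * Cr) +
        96 * (4 * κ / rs) * (8 * B / s) * (Cr * (Real.sqrt s / Real.sqrt cr + 64 * Real.sqrt s + 384 * s / (N : ℝ))) +
          96 * (4 * κ / rs) * (8 * B / s * (2 / rs)) * (Cr * (3 * s / 4))) ≤
      3 * Cr + 3072 * Cc + 3072 * Cr * (1 / Real.sqrt cr + 3138) * (κ * B) := by
  have hrs_def : Real.sqrt s = rs := by
    rw [← hsq, Real.sqrt_sq hrs0.le]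
  rw [hrs_def]
  have hsne : s ≠ 0 := hs0.ne'
  have hrsne : rs ≠ 0 := hrs0.ne'
  -- term (a): the commutator
  have hN4 : s ^ 2 ≤ 4096 * (N : ℝ) ^ 4 := by
    have h := pow_le_pow_left₀ (by positivity : 0 ≤ rs / 8) hN8 4
    have : (rs / 8) ^ 4 = s ^ 2 / 4096 := by rw [div_pow, show rs ^ 4 = (rs ^ 2) ^ 2 by ring, hsq]; norm_num
    rw [this, div_le_iff₀ (by norm_num : (0:ℝ) < 4096)] at h
    linarith only [h]
  have ta : s * (3 * s / 4 * (Cc / (N : ℝ) ^ 4)) ≤ 3072 * Cc := by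
    have hN40 : 0 < (N : ℝ) ^ 4 := by positivity
    rw [show s * (3 * s / 4 * (Cc / (N : ℝ) ^ 4)) = (3 / 4 * Cc) * (s ^ 2 / (N : ℝ) ^ 4) by ring]
    have : s ^ 2 / (N : ℝ) ^ 4 ≤ 4096 := by rw [div_le_iff₀ hN40]; linarith only [hN4]
    have hc0 : 0 ≤ 3 / 4 * Cc := by positivity
    nlinarith only [this, hc0]
  -- term (b): the free term
  have tb : s * (3 * s / 4 * (32 / (9 * s ^ 2) * Cr)) = 8 / 3 * Cr := by
    field_simp
    ring
  -- term (c): the smoothing perturbation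
  have hsN : s / (N : ℝ) ≤ 8 * rs := by
    rw [div_le_iff₀ hNpos]
    have : s = rs * rs := by rw [← hsq]; ring
    nlinarith only [hN8, this, hrs0]
  have hΛY : s * (96 * (4 * κ / rs) * (8 * B / s)) = 3072 * (κ * B) / rs := by
    field_simp
    ring
  have hbr : rs / Real.sqrt cr + 64 * rs + 384 * s / (N : ℝ) ≤ rs * (1 / Real.sqrt cr + 3136) := by
    have h1 : 384 * s / (N : ℝ) ≤ 3072 * rs := by
      rw [show 384 * s / (N : ℝ) = 384 * (s / (N : ℝ)) by ring]; linarith only [hsN]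
    have : rs * (1 / Real.sqrt cr + 3136) = rs / Real.sqrt cr + 64 * rs + 3072 * rs := by ring
    rw [this]
    linarith only [h1]
  have tc : s * (96 * (4 * κ / rs) * (8 * B / s) * (Cr * (rs / Real.sqrt cr + 64 * rs + 384 * s / (N : ℝ)))) ≤
      3072 * Cr * (1 / Real.sqrt cr + 3136) * (κ * B) := by
    have hpos : 0 ≤ s * (96 * (4 * κ / rs) * (8 * B / s)) * Cr := by rw [hΛY]; positivity
    calc s * (96 * (4 * κ / rs) * (8 * B / s) * (Cr * (rs / Real.sqrt cr + 64 * rs + 384 * s / (N : ℝ))))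
        = (s * (96 * (4 * κ / rs) * (8 * B / s))) * Cr * (rs / Real.sqrt cr + 64 * rs + 384 * s / (N : ℝ)) := by ring
      _ ≤ (s * (96 * (4 * κ / rs) * (8 * B / s))) * Cr * (rs * (1 / Real.sqrt cr + 3136)) :=
          mul_le_mul_of_nonneg_left hbr hpos
      _ = 3072 * Cr * (1 / Real.sqrt cr + 3136) * (κ * B) := by
          rw [hΛY]
          calc 3072 * (κ * B) / rs * Cr * (rs * (1 / Real.sqrt cr + 3136))
              = 3072 * Cr * (1 / Real.sqrt cr + 3136) * (κ * B) * (rs * rs⁻¹) := by ring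
            _ = 3072 * Cr * (1 / Real.sqrt cr + 3136) * (κ * B) := by rw [mul_inv_cancel₀ hrsne, mul_one]
  -- term (d): the `Q`-trick perturbation
  have td : s * (96 * (4 * κ / rs) * (8 * B / s * (2 / rs)) * (Cr * (3 * s / 4))) = 4608 * Cr * (κ * B) := by
    field_simp
    rw [← hsq]
    ring
  -- conclusion
  have hsum : s * (3 * s / 4 * (Cc / (N : ℝ) ^ 4 + 32 / (9 * s ^ 2) * Cr) +
      96 * (4 * κ / rs) * (8 * B / s) * (Cr * (rs / Real.sqrt cr + 64 * rs + 384 * s / (N : ℝ))) +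
        96 * (4 * κ / rs) * (8 * B / s * (2 / rs)) * (Cr * (3 * s / 4))) =
      s * (3 * s / 4 * (Cc / (N : ℝ) ^ 4)) + s * (3 * s / 4 * (32 / (9 * s ^ 2) * Cr)) +
        s * (96 * (4 * κ / rs) * (8 * B / s) * (Cr * (rs / Real.sqrt cr + 64 * rs + 384 * s / (N : ℝ)))) +
          s * (96 * (4 * κ / rs) * (8 * B / s * (2 / rs)) * (Cr * (3 * s / 4))) := by ring
  rw [hsum, tb, td]
  have hκB : 0 ≤ κ * B := by positivity
  have hCrκB : 0 ≤ Cr * (κ * B) := by positivity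
  nlinarith only [ta, tc, hCr, hκB, hCrκB, hCc]

/-- **Registered form (stub `stub_finalArith` of the crux item)**: the closing arithmetic of the main step. -/
theorem stub_finalArith :
    ∀ {s rs Cr Cc cr κ B : ℝ} {N : ℕ} (hs0 : 0 < s) (hrs0 : 0 < rs) (hsq : rs ^ 2 = s)
    (hN8 : rs / 8 ≤ ((N : ℕ) : ℝ)) (hNpos : (0 : ℝ) < N) (hCr : 0 ≤ Cr) (hCc : 0 ≤ Cc)
    (hκ : 0 ≤ κ) (hB : 0 ≤ B),
    s * (3 * s / 4 * (Cc / (N : ℝ) ^ 4 + 32 / (9 * s ^ 2) * Cr) +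
        96 * (4 * κ / rs) * (8 * B / s) * (Cr * (Real.sqrt s / Real.sqrt cr + 64 * Real.sqrt s + 384 * s / (N : ℝ))) +
          96 * (4 * κ / rs) * (8 * B / s * (2 / rs)) * (Cr * (3 * s / 4))) ≤
      3 * Cr + 3072 * Cc + 3072 * Cr * (1 / Real.sqrt cr + 3138) * (κ * B) :=
  @final_arith

end Summit.QuantumFields.QCD.Cruxes.SmallFieldUltracontractivity.PointCentredAxialParabolic

end
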